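import Summits.KontsevichZagierPeriods.KontsevichZagierPeriods.Theses.FurushoPentagon
import Summits.KontsevichZagierPeriods.KontsevichZagierPeriods.Theorems.FurushoPentagonReducedPeriodRingLinStokesSymDefs
import Summits.KontsevichZagierPeriods.KontsevichZagierPeriods.Theorems.FurushoPentagonReducedPeriodRingSubdivGeneration
import Summits.KontsevichZagierPeriods.KontsevichZagierPeriods.Theorems.FurushoPentagonSectorToKernelStokesSpanCalibration
import Literature.NumberTheory.Transcendental.KZCubicalCalculus
import Literature.NumberTheory.Transcendental.KZProductIdeal
import Literature.NumberTheory.Transcendental.SemialgebraicMapsProofs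
import Literature.NumberTheory.Transcendental.SemialgebraicLineDeriv
import Mathlib.LinearAlgebra.Matrix.Adjugate
import Mathlib.Analysis.Calculus.Deriv.Mul
import Mathlib.Analysis.Calculus.Deriv.Add
import Mathlib.Analysis.Calculus.FDeriv.Symmetric
import Mathlib.Analysis.Calculus.FDeriv.Analytic
import Mathlib.Analysis.Calculus.FDeriv.Prod

/-!
# `ReducedPeriodRing`, line `lin-stokes-sym`: determinant calculus for the change of variables

Helper file for the stub `stub_covGeneration` of crux `FurushoPentagon.ReducedPeriodRing`
(stmt-KontsevichZagierPeriods-3929), line `lin-stokes-sym`. The face-preserving change of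
variables `u = Φ(x)` of the cube is put into Ayoub's relation module by the straight-line homotopy
`φ(x, y) = (1 − y)x + yΦ(x)` and the closedness of the pulled-back volume form
`φ*(f du₁ ∧ ⋯ ∧ duₙ)`; in coordinates, with `J = ∂ₓφ`, `v = ∂_yφ = Φ(x) − x`,
`B = f(φ)·det J` and `A_j = f(φ)·det J[col j ↦ v]`, closedness is the identity
`∂_y B = Σⱼ ∂ⱼ A_j`. This file supplies the three pieces of linear algebra behind it:

* `hasDerivAt_matrix_det` — Jacobi's formula along a curve of matrices, column form:
  `(det A)' = Σ_k det A[col k ↦ A'_k]` (Leibniz expansion and the product rule);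
* `sum_det_updateCol_mul_apply_col` — Cramer's rule in the form
  `Σⱼ det J[col j ↦ v] · L(J_j) = det J · L(v)` for a linear functional `L` (the chain-rule terms);
* `sum_sum_erase_det_updateCol_updateCol` — `Σ_{j ≠ k} det J[col j ↦ v][col k ↦ H j k] = 0` for a
  symmetric family of columns `H j k = H k j` (the second-derivative terms cancel in pairs by
  swapping two columns);

and three pieces of calculus: symmetry of mixed partial derivatives of analytic functions
(`fderiv_fderiv_apply_comm`), the chain rule under a coordinate permutation
(`fderiv_comp_perm_apply`), the vanishing of tangential derivatives of a function constant on a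
face of the cube (`fderiv_apply_single_eq_zero_of_eqOn_face`), and the identification of the
Jacobian matrix of partial derivatives with `(fderiv ℝ Φ x).det` (`det_of_fderiv_comp_apply`).

References: M. Kontsevich, D. Zagier, *Periods* (2001), §1.2 rule (2); J. Ayoub, *Periods and
the conjectures of Grothendieck and Kontsevich–Zagier*, EMS Newsl. 91 (2014), Def. 10.
-/

noncomputable section

namespace Summit.KontsevichZagierPeriods.FurushoPentagon.ReducedPeriodRing.LinStokesSym

open Set
open Literature.NumberTheory.Transcendental
open Literature.NumberTheory.Transcendental.KZ

namespace CovGeneration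

open Summit.KontsevichZagierPeriods.FurushoPentagon.SectorToKernel
open SubdivGeneration (hasDerivAt_update_slice analyticOnNhd_comp_perm isSemialgebraicFunOn_comp_perm
  isTameCube_reindex of_mem_of_integrand_zero)

/-! ### Linear algebra of the closedness identity -/

/-- **Jacobi's formula, column form.** Along a curve of matrices `s ↦ A s` with entrywise
derivatives `A'` at `t`, `s ↦ det (A s)` has derivative `Σ_k det (A t)[col k ↦ A'_k]`
(Leibniz expansion and the product rule). [folklore] -/
theorem hasDerivAt_matrix_det {ι : Type*} [Fintype ι] [DecidableEq ι] {A : ℝ → Matrix ι ι ℝ}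
    {A' : Matrix ι ι ℝ} {t : ℝ} (hA : ∀ i j, HasDerivAt (fun s => A s i j) (A' i j) t) :
    HasDerivAt (fun s => (A s).det) (∑ k, ((A t).updateCol k fun i => A' i k).det) t := by
  simp only [Matrix.det_apply']
  have h : HasDerivAt (fun s => ∑ σ : Equiv.Perm ι, ((Equiv.Perm.sign σ : ℤ) : ℝ) * ∏ i, A s (σ i) i)
      (∑ σ : Equiv.Perm ι, ((Equiv.Perm.sign σ : ℤ) : ℝ) *
        ∑ k, (∏ i ∈ Finset.univ.erase k, A t (σ i) i) * A' (σ k) k) t := by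
    refine HasDerivAt.fun_sum fun σ _ => HasDerivAt.const_mul _ ?_
    have := HasDerivAt.fun_finsetProd (u := Finset.univ) (x := t)
      (f := fun i s => A s (σ i) i) (f' := fun i => A' (σ i) i) fun i _ => hA (σ i) i
    simpa only [smul_eq_mul] using this
  refine h.congr_deriv ?_
  rw [Finset.sum_comm]
  refine Finset.sum_congr rfl fun σ _ => ?_
  rw [Finset.mul_sum]
  refine Finset.sum_congr rfl fun k _ => ?_
  rw [← Finset.mul_prod_erase Finset.univ _ (Finset.mem_univ k), Matrix.updateCol_self,
    Finset.prod_congr rfl fun i hi => Matrix.updateCol_ne (Finset.ne_of_mem_erase hi)]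
  ring

/-- **Cramer's rule, summed against a linear functional**: `Σⱼ det J[col j ↦ v] · L(col j of J)
= det J · L(v)` (`J · cramer J v = det J · v`). [folklore] -/
theorem sum_det_updateCol_mul_apply_col {ι : Type*} [Fintype ι] [DecidableEq ι]
    (M : Matrix ι ι ℝ) (v : ι → ℝ) (L : (ι → ℝ) →L[ℝ] ℝ) :
    ∑ j, (M.updateCol j v).det * L (fun i => M i j) = M.det * L v := by
  have h1 : ∑ j, (M.updateCol j v).det • (fun i => M i j) = M.mulVec (M.cramer v) := by
    ext i
    simp only [Finset.sum_apply, Pi.smul_apply, smul_eq_mul, Matrix.mulVec, dotProduct,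
      Matrix.cramer_apply]
    exact Finset.sum_congr rfl fun j _ => mul_comm _ _
  calc ∑ j, (M.updateCol j v).det * L (fun i => M i j)
      = L (∑ j, (M.updateCol j v).det • (fun i => M i j)) := by simp [map_sum, map_smul]
    _ = M.det * L v := by rw [h1, Matrix.mulVec_cramer, map_smul, smul_eq_mul]

/-- Swapping the two updated columns: for `j ≠ k`,
`det M[col k ↦ v][col j ↦ c] = −det M[col j ↦ v][col k ↦ c]`. [folklore] -/
theorem det_updateCol_updateCol_swap {ι : Type*} [Fintype ι] [DecidableEq ι] (M : Matrix ι ι ℝ)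
    (v c : ι → ℝ) {j k : ι} (hjk : j ≠ k) :
    ((M.updateCol k v).updateCol j c).det = -((M.updateCol j v).updateCol k c).det := by
  have hmat : (M.updateCol k v).updateCol j c =
      ((M.updateCol j v).updateCol k c).submatrix id (Equiv.swap j k) := by
    ext a b
    simp only [Matrix.submatrix_apply, id_eq, Matrix.updateCol_apply]
    by_cases hbj : b = j
    · subst hbj
      simp [Equiv.swap_apply_left]
    · by_cases hbk : b = k
      · subst hbk
        simp [Equiv.swap_apply_right, hbj, hjk]
      · simp [Equiv.swap_apply_of_ne_of_ne hbj hbk, hbj, hbk]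
  rw [hmat, Matrix.det_permute', Equiv.Perm.sign_swap hjk]
  simp

/-- **The second-derivative terms cancel in pairs**: for a family of columns symmetric in its two
indices, `Σⱼ Σ_{k ≠ j} det M[col j ↦ v][col k ↦ H j k] = 0` (the `(j,k)` and `(k,j)` matrices
differ by a transposition of columns). [folklore] -/
theorem sum_sum_erase_det_updateCol_updateCol {ι : Type*} [Fintype ι] [DecidableEq ι]
    (M : Matrix ι ι ℝ) (v : ι → ℝ) (H : ι → ι → ι → ℝ) (hH : ∀ j k, H j k = H k j) :
    ∑ j, ∑ k ∈ Finset.univ.erase j, ((M.updateCol j v).updateCol k (H j k)).det = 0 := by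
  set T : ι → ι → ℝ := fun j k => ((M.updateCol j v).updateCol k (H j k)).det with hT
  have hanti : ∀ j k, j ≠ k → T k j = -T j k := by
    intro j k hjk
    simp only [hT, hH k j]
    exact det_updateCol_updateCol_swap M v (H j k) hjk
  have hS : ∑ j, ∑ k ∈ Finset.univ.erase j, T j k = ∑ k, ∑ j ∈ Finset.univ.erase k, T j k :=
    Finset.sum_comm' fun j k => by
      simp only [Finset.mem_univ, true_and, and_true, Finset.mem_erase, ne_eq]
      exact ⟨fun h => Ne.symm h, fun h => Ne.symm h⟩
  have key : ∑ j, ∑ k ∈ Finset.univ.erase j, T j k = -∑ j, ∑ k ∈ Finset.univ.erase j, T j k :=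
    calc ∑ j, ∑ k ∈ Finset.univ.erase j, T j k = ∑ k, ∑ j ∈ Finset.univ.erase k, T j k := hS
      _ = ∑ k, ∑ j ∈ Finset.univ.erase k, -T k j :=
          Finset.sum_congr rfl fun k _ => Finset.sum_congr rfl fun j hj =>
            hanti k j (Finset.ne_of_mem_erase hj).symm
      _ = -∑ k, ∑ j ∈ Finset.univ.erase k, T k j := by simp [Finset.sum_neg_distrib]
  linarith

/-- Splitting off the diagonal term of `Σ_k`: `Σ_k g k = g j + Σ_{k ≠ j} g k`. [folklore] -/
theorem sum_eq_add_sum_erase {ι : Type*} [Fintype ι] [DecidableEq ι] (g : ι → ℝ) (j : ι) :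
    ∑ k, g k = g j + ∑ k ∈ Finset.univ.erase j, g k :=
  (Finset.add_sum_erase Finset.univ g (Finset.mem_univ j)).symm

/-! ### Calculus -/

/-- **Symmetry of mixed partial derivatives** of a real-analytic function:
`∂_v (∂_u g) = ∂_u (∂_v g)`. [folklore] -/
theorem fderiv_fderiv_apply_comm {E : Type*} [NormedAddCommGroup E] [NormedSpace ℝ E]
    {g : E → ℝ} {x : E} (hg : AnalyticAt ℝ g x) (u v : E) :
    fderiv ℝ (fun z => fderiv ℝ g z u) x v = fderiv ℝ (fun z => fderiv ℝ g z v) x u := by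
  have hd : DifferentiableAt ℝ (fderiv ℝ g) x := hg.fderiv.differentiableAt
  have h1 : ∀ w, fderiv ℝ (fun z => fderiv ℝ g z w) x = (fderiv ℝ (fderiv ℝ g) x).flip w := by
    intro w
    rw [fderiv_clm_apply hd (differentiableAt_const w)]
    simp
  rw [h1, h1]
  simp only [ContinuousLinearMap.flip_apply]
  exact (hg.contDiffAt (n := ⊤)).isSymmSndFDerivAt_of_omega v u

/-- **Chain rule under a coordinate permutation**: the derivative of `z ↦ G (z ∘ σ)` at `w` in the
direction `v` is the derivative of `G` at `w ∘ σ` in the direction `v ∘ σ`. [folklore] -/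
theorem fderiv_comp_perm_apply {m : ℕ} {G : (Fin m → ℝ) → ℝ} (σ : Equiv.Perm (Fin m))
    {w : Fin m → ℝ} (hG : DifferentiableAt ℝ G (fun i => w (σ i))) (v : Fin m → ℝ) :
    fderiv ℝ (fun z : Fin m → ℝ => G (fun i => z (σ i))) w v =
      fderiv ℝ G (fun i => w (σ i)) (fun i => v (σ i)) := by
  set L : (Fin m → ℝ) →L[ℝ] (Fin m → ℝ) :=
    ContinuousLinearMap.pi fun i => ContinuousLinearMap.proj (σ i) with hL
  have hLz : ∀ z : Fin m → ℝ, L z = fun i => z (σ i) := fun z => rfl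
  have h := (hG.hasFDerivAt).comp w L.hasFDerivAt
  have hfun : (fun z : Fin m → ℝ => G (fun i => z (σ i))) = G ∘ L := rfl
  rw [hfun, h.fderiv]
  rfl

/-- A transposition `τ = (b a)` turns the coordinate vector `e_a` into `e_b`:
`e_a ∘ τ = e_b`. [folklore] -/
theorem single_comp_swap {m : ℕ} (a b : Fin m) :
    (fun i => (Pi.single a (1 : ℝ) : Fin m → ℝ) (Equiv.swap b a i)) = Pi.single b 1 := by
  funext i
  rcases eq_or_ne i b with rfl | hib
  · simp [Equiv.swap_apply_left]
  · rcases eq_or_ne i a with rfl | hia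
    · simp [Equiv.swap_apply_right, hib, Ne.symm hib]
    · simp [Equiv.swap_apply_of_ne_of_ne hib hia, hia, hib]

/-- A transposition is an involution on coordinate vectors: `(w ∘ τ) ∘ τ = w`. [folklore] -/
theorem comp_swap_comp_swap {m : ℕ} (a b : Fin m) (w : Fin m → ℝ) :
    (fun i => (fun k => w (Equiv.swap b a k)) (Equiv.swap b a i)) = w := by
  funext i
  simp [Equiv.swap_apply_self]

/-- **Partial derivatives as last-coordinate derivatives.** For `τ = (b last)`,
`∂_b G (w) = ∂_last (G ∘ τ) (w ∘ τ)`. [folklore] -/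
theorem fderiv_apply_single_eq_comp_swap {m : ℕ} {G : (Fin (m + 1) → ℝ) → ℝ} (b : Fin (m + 1))
    {w : Fin (m + 1) → ℝ} (hG : DifferentiableAt ℝ G w) :
    fderiv ℝ G w (Pi.single b 1) =
      fderiv ℝ (fun z : Fin (m + 1) → ℝ => G (fun i => z (Equiv.swap b (Fin.last m) i)))
        (fun k => w (Equiv.swap b (Fin.last m) k)) (Pi.single (Fin.last m) 1) := by
  have hG' : DifferentiableAt ℝ G
      (fun i => (fun k => w (Equiv.swap b (Fin.last m) k)) (Equiv.swap b (Fin.last m) i)) := by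
    rwa [comp_swap_comp_swap]
  rw [fderiv_comp_perm_apply (Equiv.swap b (Fin.last m)) hG', comp_swap_comp_swap,
    single_comp_swap]

/-- **Tangential derivatives vanish on a face.** If `g` is constant (`= c`) on the face
`{x ∈ [0,1]ⁿ | x_j = a}` and differentiable at a point `z` of that face, then `∂_k g (z) = 0` for
every `k ≠ j` (the coordinate segment through `z` in direction `k` stays in the face, and
derivatives within `[0,1]` are unique). [folklore] -/
theorem fderiv_apply_single_eq_zero_of_eqOn_face {n : ℕ} {g : (Fin n → ℝ) → ℝ} {z : Fin n → ℝ}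
    (hz : z ∈ cube n) {j k : Fin n} (hkj : k ≠ j) {a c : ℝ} (hzj : z j = a)
    (hconst : ∀ x ∈ cube n, x j = a → g x = c) (hg : DifferentiableAt ℝ g z) :
    fderiv ℝ g z (Pi.single k 1) = 0 := by
  have h1 : HasDerivAt (fun b => g (Function.update z k b)) (fderiv ℝ g z (Pi.single k 1)) (z k) := by
    have hg' : DifferentiableAt ℝ g (Function.update z k (z k)) := by rwa [Function.update_eq_self]
    simpa only [Function.update_eq_self] using hasDerivAt_update_slice hg'
  have h2 : HasDerivWithinAt (fun b => g (Function.update z k b)) 0 (Icc (0 : ℝ) 1) (z k) := by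
    refine (hasDerivWithinAt_const (z k) (Icc (0 : ℝ) 1) c).congr_of_mem (fun b hb => ?_)
      ⟨(hz k).1, (hz k).2⟩
    exact hconst _ (update_mem_cube hz k hb.1 hb.2) (by rw [Function.update_of_ne hkj.symm, hzj])
  exact (uniqueDiffOn_Icc zero_lt_one _ ⟨(hz k).1, (hz k).2⟩).eq_deriv _ h1.hasDerivWithinAt h2

/-- **The Jacobian matrix of partial derivatives has determinant `(fderiv ℝ Φ x).det`.**
[folklore] -/
theorem det_of_fderiv_comp_apply {n : ℕ} {Φ : (Fin n → ℝ) → (Fin n → ℝ)} {x : Fin n → ℝ}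
    (hΦ : ∀ i, DifferentiableAt ℝ (fun x => Φ x i) x) :
    (Matrix.of fun i k => fderiv ℝ (fun x => Φ x i) x (Pi.single k 1)).det = (fderiv ℝ Φ x).det := by
  have hd : DifferentiableAt ℝ Φ x := differentiableAt_pi.2 hΦ
  have hmat : Matrix.of (fun i k => fderiv ℝ (fun x => Φ x i) x (Pi.single k 1)) =
      LinearMap.toMatrix' ((fderiv ℝ Φ x : (Fin n → ℝ) →L[ℝ] (Fin n → ℝ)) :
        (Fin n → ℝ) →ₗ[ℝ] (Fin n → ℝ)) := by
    ext i k
    rw [LinearMap.toMatrix'_apply, Matrix.of_apply, fderiv_apply hd i]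
    rfl
  rw [hmat, LinearMap.det_toMatrix']


/-! ### Tame cube bookkeeping -/

/-- The determinant of a square matrix of functions analytic near a set is analytic near it
(Leibniz expansion). [folklore] -/
theorem analyticOnNhd_matrix_det {E : Type*} [NormedAddCommGroup E] [NormedSpace ℝ E] {ι : Type*}
    [Fintype ι] [DecidableEq ι] {s : Set E} {M : E → Matrix ι ι ℝ}
    (hM : ∀ i j, AnalyticOnNhd ℝ (fun x => M x i j) s) :
    AnalyticOnNhd ℝ (fun x => (M x).det) s := by
  simp only [Matrix.det_apply']
  exact Finset.analyticOnNhd_fun_sum _ fun σ _ =>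
    analyticOnNhd_const.mul (Finset.analyticOnNhd_fun_prod _ fun i _ => hM _ _)

/-- **Partial derivatives of a function analytic near the closed cube and `ℚ`-semialgebraic on it
are `ℚ`-semialgebraic on the closed cube, in EVERY coordinate**: conjugate the last-coordinate
case (`stokesCal_isSemialgebraicFunOn_fderiv_last`, Basu–Pollack–Roy Prop. 3.22 plus a closure of
the graph) by the transposition `(b last)`. [Basu–Pollack–Roy 2006, Prop. 3.22] -/
theorem isSemialgebraicFunOn_fderiv_apply_single {m : ℕ} {G : (Fin m → ℝ) → ℝ}
    (hGa : AnalyticOnNhd ℝ G (cube m)) (hGs : IsSemialgebraicFunOn ℚ (cube m) G) (b : Fin m) :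
    IsSemialgebraicFunOn ℚ (cube m) (fun w => fderiv ℝ G w (Pi.single b 1)) := by
  cases m with
  | zero => exact b.elim0
  | succ m =>
    have hD := stokesCal_isSemialgebraicFunOn_fderiv_last
      (analyticOnNhd_comp_perm hGa (Equiv.swap b (Fin.last m)))
      (isSemialgebraicFunOn_comp_perm hGs (Equiv.swap b (Fin.last m)))
    refine (isSemialgebraicFunOn_comp_perm hD (Equiv.swap b (Fin.last m))).congr fun w hw => ?_
    exact (fderiv_apply_single_eq_comp_swap b (hGa w hw).differentiableAt).symm

/-- **Congruence**: two tame cubes whose integrands agree on the cube are congruent modulo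
`linStokesSymIdeal` (`[R] − [S] − [0] ∈ Lin` and `[0] ∈ Lin`). [Kontsevich–Zagier 2001, §1.2 rule (1)] -/
theorem of_sub_of_mem_of_eqOn {m : ℕ} {R S : IntegralRep m} (hR : R.IsTameCube)
    (hS : S.IsTameCube) (h : EqOn R.integrand S.integrand (cube m)) :
    of R - of S ∈ linStokesSymIdeal := by
  obtain ⟨R₀, hR₀d, hR₀i⟩ := exists_zeroRep (σ := cube m) isSemialgebraic_cube
  have hR₀t : R₀.IsTameCube := ⟨hR₀d, by rw [hR₀i]; exact analyticOnNhd_const⟩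
  have hL : of R - of S - of R₀ ∈ linStokesSymIdeal := cubicalLinGens_subset_linStokesSymIdeal
    (mem_cubicalLinGens hR hS hR₀t fun x hx => by simp [hR₀i, h hx])
  have h₀ : of R₀ ∈ linStokesSymIdeal := of_mem_of_integrand_zero hR₀t fun x _ => by simp [hR₀i]
  simpa only [sub_add_cancel] using linStokesSymIdeal.add_mem hL h₀

/-- **Iterated linearity**: a tame cube whose integrand is, on the cube, the sum of the integrands
of finitely many tame cubes is congruent to their sum modulo `linStokesSymIdeal`.
[Kontsevich–Zagier 2001, §1.2 rule (1)] -/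
theorem of_sub_sum_of_mem {m : ℕ} {ι : Type*} (s : Finset ι) (S : ι → IntegralRep m)
    (hS : ∀ j ∈ s, (S j).IsTameCube) :
    ∀ R : IntegralRep m, R.IsTameCube →
      EqOn R.integrand (fun x => ∑ j ∈ s, (S j).integrand x) (cube m) →
      of R - ∑ j ∈ s, of (S j) ∈ linStokesSymIdeal := by
  classical
  induction s using Finset.induction_on with
  | empty =>
    intro R hR h
    simp only [Finset.sum_empty, sub_zero]
    exact of_mem_of_integrand_zero hR fun x hx => by simpa using h hx
  | insert a s ha ih =>
    intro R hR h
    have hsa : ∀ j ∈ s, (S j).IsTameCube := fun j hj => hS j (Finset.mem_insert_of_mem hj)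
    have hPa : AnalyticOnNhd ℝ (fun x => ∑ j ∈ s, (S j).integrand x) (cube m) :=
      Finset.analyticOnNhd_fun_sum s fun j hj => (hsa j hj).2
    have hPs : IsSemialgebraicFunOn ℚ (cube m) (fun x => ∑ j ∈ s, (S j).integrand x) :=
      IsSemialgebraicFunOn.fun_finsetSum s isSemialgebraic_cube
        fun j hj => (hsa j hj).isSemialgebraicFunOn
    have hR't : (IntegralRep.tameCube _ hPa hPs).IsTameCube :=
      IntegralRep.isTameCube_tameCube _ hPa hPs
    have hL : of R - of (S a) - of (IntegralRep.tameCube _ hPa hPs) ∈ linStokesSymIdeal :=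
      cubicalLinGens_subset_linStokesSymIdeal
        (mem_cubicalLinGens hR (hS a (Finset.mem_insert_self a s)) hR't fun x hx => by
          rw [Pi.add_apply, h hx, IntegralRep.tameCube_integrand]
          exact Finset.sum_insert ha)
    have hI := ih hsa (IntegralRep.tameCube _ hPa hPs) hR't fun x _ => rfl
    rw [Finset.sum_insert ha, show of R - (of (S a) + ∑ j ∈ s, of (S j)) =
      (of R - of (S a) - of (IntegralRep.tameCube _ hPa hPs)) +
        (of (IntegralRep.tameCube _ hPa hPs) - ∑ j ∈ s, of (S j)) by abel]
    exact linStokesSymIdeal.add_mem hL hI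

/-- **A coordinate symmetry followed by Newton–Leibniz with vanishing boundary values.** For a
tame `(n+1)`-cube `R` with integrand `∂_last G` (`G` analytic near the cube, `ℚ`-semialgebraic on
it) and `G(x, 1) = G(x, 0)` for `x ∈ [0,1]ⁿ`, both `[R]` and `[R.reindex τ]` lie in
`linStokesSymIdeal` for every permutation `τ`. [Ayoub 2014, Def. 10] -/
theorem of_reindex_mem_of_boundary_eq {n : ℕ} {G : (Fin (n + 1) → ℝ) → ℝ}
    (hGa : AnalyticOnNhd ℝ G (cube (n + 1))) (hGs : IsSemialgebraicFunOn ℚ (cube (n + 1)) G)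
    {R : IntegralRep (n + 1)} (hR : R.IsTameCube)
    (hRi : R.integrand = fun w => fderiv ℝ G w (Pi.single (Fin.last n) 1))
    (hbd : ∀ x ∈ cube n, G (Fin.snoc x 1) = G (Fin.snoc x 0)) (τ : Equiv.Perm (Fin (n + 1))) :
    of R ∈ linStokesSymIdeal ∧ of (R.reindex τ) ∈ linStokesSymIdeal := by
  obtain ⟨R₀, hR₀d, hR₀i⟩ := exists_zeroRep (σ := cube n) isSemialgebraic_cube
  have hR₀t : R₀.IsTameCube := ⟨hR₀d, by rw [hR₀i]; exact analyticOnNhd_const⟩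
  have h₀ : of R₀ ∈ linStokesSymIdeal := of_mem_of_integrand_zero hR₀t fun x _ => by simp [hR₀i]
  have hSt : of R - of R₀ ∈ linStokesSymIdeal := by
    refine cubicalStokesGens_subset_linStokesSymIdeal (mem_cubicalStokesGens hR hR₀t hGa hGs
      (fun x hx t ht => ?_) fun x hx => ?_)
    · rw [hRi]
      exact stokesCal_hasDerivAt_snoc (hGa _ (snoc_mem_cube_iff.2 ⟨hx, ht.1, ht.2⟩)).differentiableAt
    · simp [hR₀i, hbd x hx]
  have hRm : of R ∈ linStokesSymIdeal := by simpa using linStokesSymIdeal.add_mem hSt h₀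
  refine ⟨hRm, ?_⟩
  simpa using linStokesSymIdeal.sub_mem hRm (of_sub_of_reindex_mem_linStokesSymIdeal hR τ)

/-- Anchor of this helper file (registered sub-goal `stub_covGeneration_det` of crux
stmt-KontsevichZagierPeriods-3929, serving `stub_covGeneration` of line `lin-stokes-sym`): Jacobi's
formula along a curve of real matrices, column form (`hasDerivAt_matrix_det`). [folklore] -/
theorem stub_covGeneration_det : ∀ (m : ℕ) (M : ℝ → Matrix (Fin m) (Fin m) ℝ) (M' : Matrix (Fin m) (Fin m) ℝ) (t : ℝ), (∀ i j, HasDerivAt (fun s => M s i j) (M' i j) t) → HasDerivAt (fun s => (M s).det) (∑ k, ((M t).updateCol k fun i => M' i k).det) t :=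
  fun _ _ _ _ h => hasDerivAt_matrix_det h

end CovGeneration

end Summit.KontsevichZagierPeriods.FurushoPentagon.ReducedPeriodRing.LinStokesSym
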